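import Summits.QuantumFields.BalabanUV.T4Continuum.Support.NE3FrameFreeDecompositionPrep
import Mathlib.LinearAlgebra.BilinearForm.Properties
import HarnessLib

/-!
# NE3CornerGaugeSpace (T⁴ programme, node NE3, row Φ6-FLAT of the owner's rulings ρ-g21-3 ∕ ρ-g21-4 (W4), file 2∕3) — THE
# PERIODISED SITE BUMPS, «⊥ dPot Ξ₀₀ ⟹ BLOCKWISE-CONSTANT DIVERGENCE», AND THE FINITE-DIMENSIONAL ℝ-SPACE `Ξ₀₀^{𝔲(n)}(P, M)`
# OF CORNER-TRIVIAL BLOCK-MEAN-ZERO 𝔲(n)-GAUGES WITH ITS NONDEGENERATE `dPot`-GRAM FORM: THE PROJECTION STEP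

NE3 (node U1b) formalisation swarm `b2b-balaban-t4-ne3-formalise-*`, leaf seat `b2b-balaban-t4-ne3-formalise-leaf-02` (gen 5),
row **Φ6-flat** (owner design `HOME/t4/b2b-balaban-t4-ne3-p1/g21/D-ne3p1-g21-2.md` §2, ruling ρ-g21-4 (W4)); INTENT in
`HOME/CLAIMS.log` 2026-08-20T15:38:09Z; file 1 = `NE3FrameFreeDecompositionPrep`.  THIS FILE is the «block-mean-zero Poisson
step» named by row NE3-R2 (journal ≈15:35Z): the ℓ²(periodBox)-projection of a direction field onto `dPot Ξ₀₀`, done DIRECTLY for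
𝔲(n)-valued fields in the tree's real Hilbert–Schmidt form `hsR` — no entrywise reduction, no symmetrisation.  All [folklore],
0 sorry; three DATA defs (`siteBump`, `cornerGaugeSpace`, `gram`), no `def … : Prop`:
§6 `siteBump P a S` (the value `S` on the residue class of `a` mod `P`, else `0`): periodic, 𝔲(n)-valued for skew `S`,
   `sum_hsR_siteBump` (pairing EVALUATES at `a mod P`), **`wrap_block_eq_iff`** (`M•z′ + u ≡ M•z + v (mod M·N)` for
   `u, v ∈ [0,M)^d` iff `u = v ∧ z′ ≡ z (mod N)`), `sum_block_siteBump` (block sums of a bump do not depend on the in-block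
   position), `siteBump_corner` (a bump at a non-corner site vanishes on corners), and **`blockConst_of_orthogonal`**: a skew
   `(M·N)`-periodic `Z` with `Σ_{box} Σ_μ hsR (Z)(dPot η) = 0` for every `(M·N)`-periodic, corner-trivial, block-sum-zero, 𝔲(n)-valued
   `η` has `flatDiv Z` CONSTANT ON EACH `M`-BLOCK OFF ITS CORNER (test with the difference of two bumps in one block carrying the
   skew matrix `flatDiv Z a − flatDiv Z b`, which is then `hsR`-orthogonal to itself);
§7 **`cornerGaugeSpace P M : Submodule ℝ (Site d → Matrix n n ℂ)`** = Ξ₀₀^{𝔲(n)}(P, M) (P-periodic ∧ corner-trivial ∧ block-sum-zero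
   ∧ 𝔲(n)-valued), `mem_cornerGaugeSpace_iff`, **`finiteDimensional_cornerGaugeSpace`** (`P ≥ 1`: restriction to `periodBox P`
   is an injective linear map into functions on a finite set, `PeriodicChoice.apply_wrap_eq`);
§8 `dPot_add_pi`∕`dPot_smul_pi`, **`gram P M : LinearMap.BilinForm ℝ (cornerGaugeSpace P M)`**,
   `gram η ζ = Σ_{x∈periodBox P} Σ_μ hsR (dPot η x μ) (dPot ζ x μ)` (`gram_apply`), **`gram_nondegenerate`** (positive definite by
   file 1's `eq_zero_of_sum_nhsNormSq_dPot_eq_zero`), and THE PROJECTION STEP **`exists_orthogonal`**: for `P ≥ 1` and every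
   direction field `Y` there is `η ∈ Ξ₀₀^{𝔲(n)}(P, M)` with `Σ_{box} Σ_μ hsR (Y x μ + dPot η x μ) (dPot ζ x μ) = 0` for all
   `ζ ∈ Ξ₀₀^{𝔲(n)}(P, M)` — the Riesz vector `((gram P M).toDual _).symm ℓ` of `ℓ ζ := −Σ hsR (Y)(dPot ζ)`
   (`LinearMap.BilinForm.toDual` on a finite-dimensional space).
Compare leaf-01-g5's `NE3TorusProjection.exists_orthogonal_repr` (in tree; inner-product-space-valued fields via `PiLp 2` and
`Submodule.exists_add_mem_mem_orthogonal`): the same projection for Hilbert-space values; `Matrix n n ℂ` carries the L2-OPERATOR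
norm in the tree, not an `InnerProductSpace` instance, hence the bilinear-form route here.
HONEST FRAMING.  Flat finite-torus linear algebra in our frame; nothing about Bałaban's minimisers, (P♮) at `W ≠ 1`, (ML_w), T-E_w
or NE3 is asserted; NE3 NOT proved; spine PROVED 0∕9; finite T⁴ rung (B)+1 — NOT infinite volume, NOT mass gap, NOT BetaPertH, NOT
Clay.  ABSOLUTE RULE kept: no printed sentence is a hypothesis (context only: [Balaban1985Averaging] (47)–(48) p. 25,
(120)–(125) pp. 35–36; [Balaban1985Variational] (83) p. 290).  PLACEMENT: `Summits/QuantumFields/BalabanUV/`; imports file 1 and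
`Mathlib.LinearAlgebra.BilinearForm.Properties`; moves nothing.  HONEST DEPENDENCY: continuum YM on T⁴ ⇐ BetaPertH ∧ nine spine
estimates (0/9 proved); BetaPertH ⇐ (D1) ∧ (D4) ∧ CAP+tail; G-an2-4 gates asym, D1 and NE2/3/4.
-/

set_option autoImplicit false

open scoped BigOperators Matrix.Norms.L2Operator
open Finset

namespace Summit.QuantumFields.BalabanUV.T4Continuum.NE3CornerGaugeSpace

open Literature.MathematicalPhysics.QuantumFieldTheory.Balaban1983to89
open B7Prop1Explicit B7Prop3Flat MatrixNorms
open T4AveragingDeficitWall (IsSkewDir)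
open T4AveragingDeficitWallBoundary (periodBox mem_periodBox)
open AveragingDeficitPeriodicCounting (IsPeriodicDir)
open NE3TangentNoGoWords (dPot)
open NE3CovariantCalculus (hsR hsR_add_left hsR_add_right hsR_sub_left hsR_sub_right hsR_self hsR_comm hsR_sum_left
  hsR_sum_right)
open NE3LandauOrbit (hsR_zero_left hsR_zero_right eq_zero_of_nhsNormSq_eq_zero)
open NE3CoercivityScaling (flatDiv)
open PeriodicChoice (apply_wrap_eq wrap_mem_periodBox wrap_add_smul_e)
open NE3FrameFreeDecompositionPrep

noncomputable section

variable {d : ℕ} {n : Type*} [Fintype n] [DecidableEq n]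

/-! ## §6 The two-site test fields; orthogonality forces a blockwise-constant divergence -/

/-- THE PERIODISED SITE BUMP: `siteBump P a S y = S` if `y ≡ a (mod P)` coordinatewise, else `0`. [folklore] -/
def siteBump (P : ℕ) (a : Site d) (S : Matrix n n ℂ) : Site d → Matrix n n ℂ :=
  fun y => if (fun κ => y κ % (P : ℤ)) = (fun κ => a κ % (P : ℤ)) then S else 0

omit [Fintype n] [DecidableEq n] in
/-- The site bump is `P`-periodic. [folklore] -/
theorem siteBump_add_period (P : ℕ) (a : Site d) (S : Matrix n n ℂ) (y : Site d) (κ : Fin d) :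
    siteBump P a S (y + (P : ℤ) • e κ) = siteBump P a S y := by
  unfold siteBump
  rw [wrap_add_smul_e]

omit [Fintype n] [DecidableEq n] in
/-- The site bump of a skew matrix is 𝔲(n)-valued. [folklore] -/
theorem siteBump_mem_skewAdjoint (P : ℕ) (a : Site d) {S : Matrix n n ℂ} (hS : S ∈ skewAdjoint (Matrix n n ℂ)) (y : Site d) :
    siteBump P a S y ∈ skewAdjoint (Matrix n n ℂ) := by
  unfold siteBump
  split_ifs
  · exact hS
  · exact (skewAdjoint (Matrix n n ℂ)).zero_mem

/-- Pairing with the site bump EVALUATES at the wrapped site: `Σ_{x∈periodBox P} hsR (D x) (siteBump P a S x) =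
hsR (D (a mod P)) S` (`P ≥ 1`). [folklore] -/
theorem sum_hsR_siteBump {P : ℕ} (hP : 1 ≤ P) (D : Site d → Matrix n n ℂ) (a : Site d) (S : Matrix n n ℂ) :
    ∑ x ∈ periodBox (d := d) P, hsR (D x) (siteBump P a S x) = hsR (D (fun κ => a κ % (P : ℤ))) S := by
  have h1 : ∀ x ∈ periodBox (d := d) P, hsR (D x) (siteBump P a S x)
      = if x = (fun κ => a κ % (P : ℤ)) then hsR (D x) S else 0 := by
    intro x hx
    unfold siteBump
    rw [wrap_eq_self_of_mem hx]
    split_ifs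
    · rfl
    · exact hsR_zero_right _
  rw [Finset.sum_congr rfl h1, Finset.sum_ite_eq', if_pos (wrap_mem_periodBox P hP a)]

/-- **THE CONGRUENCE `M•z′ + u ≡ M•z + v (mod M·N)` FOR `u, v ∈ [0,M)^d`** holds iff `u = v` and `z′ ≡ z (mod N)`
coordinatewise (`M ≥ 1`). [folklore] -/
theorem wrap_block_eq_iff {M : ℕ} (hM : 1 ≤ M) (N : ℕ) {u v : Site d} (hu : u ∈ periodBox (d := d) M)
    (hv : v ∈ periodBox (d := d) M) (z z' : Site d) :
    (fun κ => ((M : ℤ) • z' + u) κ % ((M * N : ℕ) : ℤ)) = (fun κ => ((M : ℤ) • z + v) κ % ((M * N : ℕ) : ℤ))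
      ↔ (u = v ∧ ∀ κ, z' κ % (N : ℤ) = z κ % (N : ℤ)) := by
  have hM0 : (M : ℤ) ≠ 0 := by exact_mod_cast (by omega : M ≠ 0)
  have hub := mem_periodBox.mp hu
  have hvb := mem_periodBox.mp hv
  constructor
  · intro h
    have hκ : ∀ κ, ((M : ℤ) * z' κ + u κ) % ((M : ℤ) * N) = ((M : ℤ) * z κ + v κ) % ((M : ℤ) * N) := by
      intro κ
      have := congr_fun h κ
      simp only [Pi.add_apply, Pi.smul_apply, smul_eq_mul] at this
      push_cast at this
      exact this
    have huv : u = v := by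
      funext κ
      have h1 : ((M : ℤ) * z' κ + u κ) % (M : ℤ) = ((M : ℤ) * z κ + v κ) % (M : ℤ) :=
        Int.ModEq.of_dvd (dvd_mul_right (M : ℤ) N) (hκ κ)
      rw [add_comm, Int.add_mul_emod_self_left, add_comm, Int.add_mul_emod_self_left,
        Int.emod_eq_of_lt (hub κ).1 (hub κ).2, Int.emod_eq_of_lt (hvb κ).1 (hvb κ).2] at h1
      exact h1
    refine ⟨huv, fun κ => ?_⟩
    have h2 := hκ κ
    rw [huv] at h2
    have h3 : (M : ℤ) * z' κ ≡ (M : ℤ) * z κ [ZMOD ((M : ℤ) * N)] := Int.ModEq.add_right_cancel' (v κ) h2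
    have h4 : ((M : ℤ) * N) ∣ (M : ℤ) * z κ - (M : ℤ) * z' κ := (Int.modEq_iff_dvd.mp h3)
    rw [← mul_sub, mul_dvd_mul_iff_left hM0] at h4
    exact Int.modEq_iff_dvd.mpr h4
  · rintro ⟨rfl, hz⟩
    funext κ
    simp only [Pi.add_apply, Pi.smul_apply, smul_eq_mul]
    push_cast
    have h4 : (N : ℤ) ∣ z κ - z' κ := Int.modEq_iff_dvd.mp (hz κ)
    have h5 : ((M : ℤ) * N) ∣ ((M : ℤ) * z κ + u κ) - ((M : ℤ) * z' κ + u κ) := by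
      rw [show ((M : ℤ) * z κ + u κ) - ((M : ℤ) * z' κ + u κ) = (M : ℤ) * (z κ - z' κ) by ring]
      exact mul_dvd_mul_left _ h4
    exact Int.modEq_iff_dvd.mpr h5

omit [Fintype n] [DecidableEq n] in
/-- THE BLOCK SUMS OF A SITE BUMP: for `v ∈ [0,M)^d`, `Σ_{u∈periodBox M} siteBump (M·N) (M•z + v) S (M•z′ + u)` is `S` if
`z′ ≡ z (mod N)` and `0` otherwise — in particular INDEPENDENT OF `v` (`M ≥ 1`). [folklore] -/
theorem sum_block_siteBump {M : ℕ} (hM : 1 ≤ M) (N : ℕ) (z z' : Site d) {v : Site d} (hv : v ∈ periodBox (d := d) M)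
    (S : Matrix n n ℂ) :
    ∑ u ∈ periodBox (d := d) M, siteBump (M * N) ((M : ℤ) • z + v) S ((M : ℤ) • z' + u)
      = if (∀ κ, z' κ % (N : ℤ) = z κ % (N : ℤ)) then S else 0 := by
  by_cases hC : ∀ κ, z' κ % (N : ℤ) = z κ % (N : ℤ)
  · rw [if_pos hC]
    have h1 : ∀ u ∈ periodBox (d := d) M, siteBump (M * N) ((M : ℤ) • z + v) S ((M : ℤ) • z' + u)
        = if u = v then S else 0 := by
      intro u hu
      unfold siteBump
      by_cases huv : u = v
      · rw [if_pos huv, if_pos ((wrap_block_eq_iff hM N hu hv z z').mpr ⟨huv, hC⟩)]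
      · rw [if_neg huv, if_neg (fun h => huv ((wrap_block_eq_iff hM N hu hv z z').mp h).1)]
    rw [Finset.sum_congr rfl h1, Finset.sum_ite_eq' (periodBox (d := d) M) v (fun _ => S), if_pos hv]
  · rw [if_neg hC]
    refine Finset.sum_eq_zero fun u hu => ?_
    unfold siteBump
    rw [if_neg (fun h => hC ((wrap_block_eq_iff hM N hu hv z z').mp h).2)]

omit [Fintype n] [DecidableEq n] in
/-- A SITE BUMP AT A NON-CORNER SITE VANISHES ON THE CORNERS: for `v ∈ [0,M)^d`, `v ≠ 0`,
`siteBump (M·N) (M•z + v) S (M•w) = 0`. [folklore] -/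
theorem siteBump_corner {M : ℕ} (hM : 1 ≤ M) (N : ℕ) (z w : Site d) {v : Site d} (hv : v ∈ periodBox (d := d) M)
    (hv0 : v ≠ 0) (S : Matrix n n ℂ) : siteBump (M * N) ((M : ℤ) • z + v) S ((M : ℤ) • w) = 0 := by
  have h0 : (0 : Site d) ∈ periodBox (d := d) M :=
    mem_periodBox.mpr fun _ => ⟨le_rfl, by simp only [Pi.zero_apply]; exact_mod_cast (by omega : 0 < M)⟩
  unfold siteBump
  rw [if_neg]
  intro h
  have h' : (fun κ => ((M : ℤ) • w + 0) κ % ((M * N : ℕ) : ℤ)) = fun κ => ((M : ℤ) • z + v) κ % ((M * N : ℕ) : ℤ) := by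
    rw [add_zero]; exact h
  exact hv0 ((wrap_block_eq_iff hM N h0 hv z w).mp h').1.symm

/-- **ORTHOGONALITY TO THE CORNER-TRIVIAL BLOCK-MEAN-ZERO GAUGES FORCES A BLOCKWISE-CONSTANT DIVERGENCE.**  Let `M, N ≥ 1`,
`Z` a skew `(M·N)`-periodic direction field with `Σ_{x∈periodBox (M·N)} Σ_μ hsR (Z x μ) (dPot η x μ) = 0` for every
`(M·N)`-periodic, corner-trivial (`η (M•w) = 0`), block-sum-zero (`Σ_{v∈[0,M)^d} η (M•z + v) = 0`), 𝔲(n)-valued site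
field `η`.  Then `flatDiv Z` is constant on each block off its corner. (Test with the difference of two site bumps in one
block carrying the skew matrix `flatDiv Z (M•z+v) − flatDiv Z (M•z+v′)`.) [folklore] -/
theorem blockConst_of_orthogonal {M N : ℕ} (hM : 1 ≤ M) (hN : 1 ≤ N) {Z : Site d → Fin d → Matrix n n ℂ}
    (hZs : IsSkewDir Z) (hZP : IsPeriodicDir Z ((M * N : ℕ) : ℤ))
    (horth : ∀ η : Site d → Matrix n n ℂ, (∀ (x : Site d) (κ : Fin d), η (x + ((M * N : ℕ) : ℤ) • e κ) = η x) →
      (∀ w : Site d, η ((M : ℤ) • w) = 0) → (∀ z : Site d, ∑ v ∈ periodBox (d := d) M, η ((M : ℤ) • z + v) = 0) →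
      (∀ x : Site d, η x ∈ skewAdjoint (Matrix n n ℂ)) →
      ∑ x ∈ periodBox (d := d) (M * N), ∑ μ : Fin d, hsR (Z x μ) (dPot η x μ) = 0) :
    ∀ z : Site d, ∃ c : Matrix n n ℂ, ∀ v ∈ periodBox (d := d) M, v ≠ 0 → flatDiv Z ((M : ℤ) • z + v) = c := by
  have hP : 1 ≤ M * N := Nat.one_le_iff_ne_zero.mpr (Nat.mul_ne_zero (by omega) (by omega))
  intro z
  -- pairwise equality of the divergence at two non-corner sites of the block
  have hpair : ∀ v ∈ periodBox (d := d) M, v ≠ 0 → ∀ v' ∈ periodBox (d := d) M, v' ≠ 0 →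
      flatDiv Z ((M : ℤ) • z + v) = flatDiv Z ((M : ℤ) • z + v') := by
    intro v hv hv0 v' hv' hv0'
    set S : Matrix n n ℂ := flatDiv Z ((M : ℤ) • z + v) - flatDiv Z ((M : ℤ) • z + v') with hS_def
    have hS : S ∈ skewAdjoint (Matrix n n ℂ) :=
      (skewAdjoint (Matrix n n ℂ)).sub_mem (flatDiv_mem_skewAdjoint hZs _) (flatDiv_mem_skewAdjoint hZs _)
    set η : Site d → Matrix n n ℂ :=
      fun y => siteBump (M * N) ((M : ℤ) • z + v) S y - siteBump (M * N) ((M : ℤ) • z + v') S y with hη_def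
    have hηP : ∀ (x : Site d) (κ : Fin d), η (x + ((M * N : ℕ) : ℤ) • e κ) = η x := by
      intro x κ
      simp only [hη_def, siteBump_add_period]
    have hη0 : ∀ w : Site d, η ((M : ℤ) • w) = 0 := by
      intro w
      simp only [hη_def, siteBump_corner hM N z w hv hv0, siteBump_corner hM N z w hv' hv0', sub_self]
    have hηb : ∀ z' : Site d, ∑ u ∈ periodBox (d := d) M, η ((M : ℤ) • z' + u) = 0 := by
      intro z'
      simp only [hη_def, Finset.sum_sub_distrib, sum_block_siteBump hM N z z' hv, sum_block_siteBump hM N z z' hv',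
        sub_self]
    have hηs : ∀ x : Site d, η x ∈ skewAdjoint (Matrix n n ℂ) := fun x =>
      (skewAdjoint (Matrix n n ℂ)).sub_mem (siteBump_mem_skewAdjoint _ _ hS _) (siteBump_mem_skewAdjoint _ _ hS _)
    have h1 := horth η hηP hη0 hηb hηs
    rw [sum_hsR_dPot hP hZP hηP, neg_eq_zero] at h1
    simp only [hη_def, hsR_sub_right, Finset.sum_sub_distrib, sum_hsR_siteBump hP] at h1
    have hwa : flatDiv Z (fun κ => ((M : ℤ) • z + v) κ % ((M * N : ℕ) : ℤ)) = flatDiv Z ((M : ℤ) • z + v) :=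
      apply_wrap_eq (g := flatDiv Z) (fun y κ => flatDiv_add_period hZP y κ) _
    have hwb : flatDiv Z (fun κ => ((M : ℤ) • z + v') κ % ((M * N : ℕ) : ℤ)) = flatDiv Z ((M : ℤ) • z + v') :=
      apply_wrap_eq (g := flatDiv Z) (fun y κ => flatDiv_add_period hZP y κ) _
    rw [hwa, hwb, ← hsR_sub_left, ← hS_def, hsR_self] at h1
    exact sub_eq_zero.mp (eq_zero_of_nhsNormSq_eq_zero h1)
  by_cases hex : ∃ v₀ ∈ periodBox (d := d) M, v₀ ≠ 0
  · obtain ⟨v₀, hv₀, hv₀0⟩ := hex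
    exact ⟨flatDiv Z ((M : ℤ) • z + v₀), fun v hv hv0 => hpair v hv hv0 v₀ hv₀ hv₀0⟩
  · exact ⟨0, fun v hv hv0 => (hex ⟨v, hv, hv0⟩).elim⟩

/-! ## §7 The space `Ξ₀₀` of corner-trivial block-mean-zero 𝔲(n)-gauges; finite-dimensionality -/

/-- THE CORNER GAUGE SPACE `Ξ₀₀(P, M)`: the `ℝ`-submodule of `P`-periodic, corner-trivial (`ξ (M•w) = 0`), block-sum-zero
(`Σ_{v∈[0,M)^d} ξ (M•z + v) = 0` for every block `z`), 𝔲(n)-valued site fields on `ℤ^d`. [folklore] -/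
def cornerGaugeSpace (P M : ℕ) : Submodule ℝ (Site d → Matrix n n ℂ) where
  carrier := {ξ | (∀ (x : Site d) (κ : Fin d), ξ (x + (P : ℤ) • e κ) = ξ x) ∧ (∀ w : Site d, ξ ((M : ℤ) • w) = 0)
    ∧ (∀ z : Site d, ∑ v ∈ periodBox (d := d) M, ξ ((M : ℤ) • z + v) = 0)
    ∧ ∀ x : Site d, ξ x ∈ skewAdjoint (Matrix n n ℂ)}
  zero_mem' := ⟨fun _ _ => rfl, fun _ => rfl, fun _ => Finset.sum_const_zero, fun _ => (skewAdjoint _).zero_mem⟩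
  add_mem' := by
    rintro ξ ζ ⟨hξP, hξ0, hξb, hξs⟩ ⟨hζP, hζ0, hζb, hζs⟩
    refine ⟨fun x κ => ?_, fun w => ?_, fun z => ?_, fun x => ?_⟩
    · simp only [Pi.add_apply, hξP, hζP]
    · simp only [Pi.add_apply, hξ0, hζ0, add_zero]
    · simp only [Pi.add_apply, Finset.sum_add_distrib, hξb, hζb, add_zero]
    · exact (skewAdjoint _).add_mem (hξs x) (hζs x)
  smul_mem' := by
    rintro t ξ ⟨hξP, hξ0, hξb, hξs⟩
    refine ⟨fun x κ => ?_, fun w => ?_, fun z => ?_, fun x => ?_⟩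
    · simp only [Pi.smul_apply, hξP]
    · simp only [Pi.smul_apply, hξ0, smul_zero]
    · simp only [Pi.smul_apply, ← Finset.smul_sum, hξb, smul_zero]
    · exact skewAdjoint.smul_mem t (hξs x)

omit [Fintype n] [DecidableEq n] in
/-- Membership in `cornerGaugeSpace P M`, unfolded. [folklore] -/
theorem mem_cornerGaugeSpace_iff {P M : ℕ} {ξ : Site d → Matrix n n ℂ} :
    ξ ∈ cornerGaugeSpace (d := d) (n := n) P M ↔
      ((∀ (x : Site d) (κ : Fin d), ξ (x + (P : ℤ) • e κ) = ξ x) ∧ (∀ w : Site d, ξ ((M : ℤ) • w) = 0)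
        ∧ (∀ z : Site d, ∑ v ∈ periodBox (d := d) M, ξ ((M : ℤ) • z + v) = 0)
        ∧ ∀ x : Site d, ξ x ∈ skewAdjoint (Matrix n n ℂ)) :=
  Iff.rfl

omit [DecidableEq n] in
/-- **`Ξ₀₀(P, M)` IS FINITE-DIMENSIONAL** (`P ≥ 1`): restriction to the period box `[0,P)^d` is an injective linear map into
the finite-dimensional space of matrix-valued functions on a finite set (a periodic field factors through the wrap map,
`PeriodicChoice.apply_wrap_eq`). [folklore] -/
theorem finiteDimensional_cornerGaugeSpace {P : ℕ} (hP : 1 ≤ P) (M : ℕ) :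
    FiniteDimensional ℝ (cornerGaugeSpace (d := d) (n := n) P M) := by
  let res : cornerGaugeSpace (d := d) (n := n) P M →ₗ[ℝ] (↥(periodBox (d := d) P) → Matrix n n ℂ) :=
    { toFun := fun ξ x => (ξ : Site d → Matrix n n ℂ) x.1
      map_add' := fun _ _ => rfl
      map_smul' := fun _ _ => rfl }
  refine FiniteDimensional.of_injective res fun ξ ζ h => ?_
  apply Subtype.ext
  funext x
  have hξ := apply_wrap_eq (mem_cornerGaugeSpace_iff.mp ξ.2).1 x
  have hζ := apply_wrap_eq (mem_cornerGaugeSpace_iff.mp ζ.2).1 x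
  rw [← hξ, ← hζ]
  exact congr_fun h ⟨_, wrap_mem_periodBox P hP x⟩

/-! ## §8 The Gram form of `dPot` on `Ξ₀₀`; it is nondegenerate; the projection step -/

/-- `dPot` is additive (Pi form). [folklore] -/
theorem dPot_add_pi (Φ Ψ : Site d → Matrix n n ℂ) (x : Site d) (μ : Fin d) :
    dPot (Φ + Ψ) x μ = dPot Φ x μ + dPot Ψ x μ := by
  simp only [dPot, Pi.add_apply]
  abel

/-- `dPot` commutes with real scalars (Pi form). [folklore] -/
theorem dPot_smul_pi (t : ℝ) (Φ : Site d → Matrix n n ℂ) (x : Site d) (μ : Fin d) :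
    dPot (t • Φ) x μ = t • dPot Φ x μ := by
  simp only [dPot, Pi.smul_apply, smul_sub]

/-- THE GRAM FORM OF `dPot` OVER THE PERIOD BOX: `gram P M η ζ = Σ_{x∈periodBox P} Σ_μ hsR (dPot η x μ) (dPot ζ x μ)` as a
real bilinear form on `Ξ₀₀(P, M)`. [folklore] -/
def gram (P M : ℕ) : LinearMap.BilinForm ℝ (cornerGaugeSpace (d := d) (n := n) P M) :=
  LinearMap.mk₂ ℝ
    (fun η ζ => ∑ x ∈ periodBox (d := d) P, ∑ μ : Fin d,
      hsR (dPot (η : Site d → Matrix n n ℂ) x μ) (dPot (ζ : Site d → Matrix n n ℂ) x μ))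
    (fun η η' ζ => by
      simp only [Submodule.coe_add, dPot_add_pi, hsR_add_left, Finset.sum_add_distrib])
    (fun t η ζ => by
      simp only [Submodule.coe_smul, dPot_smul_pi, hsR_smul_left, Finset.mul_sum, smul_eq_mul])
    (fun η ζ ζ' => by
      simp only [Submodule.coe_add, dPot_add_pi, hsR_add_right, Finset.sum_add_distrib])
    (fun t η ζ => by
      simp only [Submodule.coe_smul, dPot_smul_pi, hsR_smul_right, Finset.mul_sum, smul_eq_mul])

/-- `gram` unfolded. [folklore] -/
theorem gram_apply (P M : ℕ) (η ζ : cornerGaugeSpace (d := d) (n := n) P M) :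
    gram P M η ζ = ∑ x ∈ periodBox (d := d) P, ∑ μ : Fin d,
      hsR (dPot (η : Site d → Matrix n n ℂ) x μ) (dPot (ζ : Site d → Matrix n n ℂ) x μ) :=
  rfl

/-- **THE GRAM FORM IS NONDEGENERATE** (`P ≥ 1`): it is positive definite, since `gram η η = Σ nhsNormSq (dPot η) = 0` forces
`dPot η = 0`, hence `η` constant, hence `η = η(M•0) = 0` (`eq_zero_of_sum_nhsNormSq_dPot_eq_zero`). [folklore] -/
theorem gram_nondegenerate {P : ℕ} (hP : 1 ≤ P) (M : ℕ) : (gram (d := d) (n := n) P M).Nondegenerate := by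
  have key : ∀ η : cornerGaugeSpace (d := d) (n := n) P M, gram P M η η = 0 → η = 0 := by
    intro η h
    rw [gram_apply] at h
    simp only [hsR_self] at h
    obtain ⟨hP', h0, -, -⟩ := mem_cornerGaugeSpace_iff.mp η.2
    have h00 : (η : Site d → Matrix n n ℂ) 0 = 0 := by simpa using h0 0
    exact Subtype.ext (eq_zero_of_sum_nhsNormSq_dPot_eq_zero hP hP' h00 h)
  exact ⟨fun η hη => key η (hη η), fun η hη => key η (hη η)⟩

/-- **THE PROJECTION STEP** (`P ≥ 1`): for every direction field `Y` there is `η ∈ Ξ₀₀(P, M)` with `Y + dPot η`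
`hsR`-orthogonal over the period box to `dPot ζ` for every `ζ ∈ Ξ₀₀(P, M)` — the Riesz vector of the functional
`ζ ↦ −Σ hsR (Y) (dPot ζ)` for the nondegenerate form `gram` on the finite-dimensional space `Ξ₀₀`
(`LinearMap.BilinForm.toDual`). [folklore] -/
theorem exists_orthogonal {P : ℕ} (hP : 1 ≤ P) (M : ℕ) (Y : Site d → Fin d → Matrix n n ℂ) :
    ∃ η ∈ cornerGaugeSpace (d := d) (n := n) P M, ∀ ζ ∈ cornerGaugeSpace (d := d) (n := n) P M,
      ∑ x ∈ periodBox (d := d) P, ∑ μ : Fin d, hsR (Y x μ + dPot η x μ) (dPot ζ x μ) = 0 := by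
  haveI := finiteDimensional_cornerGaugeSpace (d := d) (n := n) hP M
  let ℓ : Module.Dual ℝ (cornerGaugeSpace (d := d) (n := n) P M) :=
    { toFun := fun ζ => -∑ x ∈ periodBox (d := d) P, ∑ μ : Fin d, hsR (Y x μ) (dPot (ζ : Site d → Matrix n n ℂ) x μ)
      map_add' := fun ζ ζ' => by
        simp only [Submodule.coe_add, dPot_add_pi, hsR_add_right, Finset.sum_add_distrib, neg_add]
      map_smul' := fun t ζ => by
        simp only [Submodule.coe_smul, dPot_smul_pi, hsR_smul_right, Finset.mul_sum, RingHom.id_apply, smul_eq_mul,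
          mul_neg] }
  set η := ((gram (d := d) (n := n) P M).toDual (gram_nondegenerate hP M)).symm ℓ with hη_def
  refine ⟨η, η.2, fun ζ hζ => ?_⟩
  have h := LinearMap.BilinForm.apply_toDual_symm_apply (hB := gram_nondegenerate (d := d) (n := n) hP M) ℓ ⟨ζ, hζ⟩
  rw [← hη_def, gram_apply] at h
  have hℓ : ℓ ⟨ζ, hζ⟩ = -∑ x ∈ periodBox (d := d) P, ∑ μ : Fin d, hsR (Y x μ) (dPot ζ x μ) := rfl
  rw [hℓ] at h
  simp only [hsR_add_left, Finset.sum_add_distrib]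
  linarith

end

end Summit.QuantumFields.BalabanUV.T4Continuum.NE3CornerGaugeSpace
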